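import Summits.QuantumFields.YangMills.Theorems.FluctuationComparisonRegPrIntLOrganTangentSeedLetterShape
import Summits.QuantumFields.YangMills.Theorems.FluctuationComparisonRegPrIntLOrganTangentBondRowSum
import HarnessLib

/-!
# ROWMASS-¼: THE ROW-MASS OF THE SEED H-LETTERS — `Σ_{b′} kT b b′·e^{κ′·tdist(b,b′)} ≤ C_H(B,r)·ωT^{1∕4}·d·(2(1 + 1∕(κ∕4 − κ′)))^d`
# for `κ′ < κ∕4`, θ-FREE and SIDE-UNIFORM (the one brick `directTransport_supR` still eats; LEAD-20520 spec v1.5 §4c «OPEN BRICKS NOW: ROWMASS-¼»)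

Cell `ym3-torus` (YM ladder rung R3 = continuum `SU(2)` Yang–Mills on the three-torus — a RUNG, NOT d = 4, NOT infinite volume, NOT a mass
gap, NOT Clay).  Width seat `ym3-torus-px5` (gen 18, «width 5»); `--supports stmt-QuantumFields-20520 --as helper`, count-neutral,
definition-free, default heartbeats; no registry, binder or `Lines/` edit (registered skeleton `Lines/semiclassical_s2beta.lean` v11.4, 0∕5,
★★OWNER RULING №36, untouched); no claim on the crux.

WHAT THIS IS.  The v18 junction `directTransport_supR` (spec `Cruxes/FluctuationComparisonRegPrIntL/V18-TYPING-SPEC-w3g24.md` §4 (a)) applies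
O1ᵘ-H ONCE with input presentation `(c, a, w) := (0, 0, ωT-row-mass)` and input H-letters `k := kT`, where O1ᵘ-H's input clause (HOME draft
`O1uH_draft.lean` :88) asks for `(∀ b b′, 0 ≤ k b b′) ∧ (∀ b, ∑ b′, k b b′ * Real.exp (κ * (b.src.tdist b′.src : ℝ)) ≤ w)` — a ROW-MASS bound
with EXPONENTIAL WEIGHT.  The seed letters are pen 9's (✓p797938 `…OrganTangentSeedHClause.hClauseSq_of_seed_of_analytic`):
`kT b b′ := ⟨✓p796245's constant at ρ = rθ, a = rθ∕4, s₁ = rθ∕8, r = r′ = 1∕2, σ := ωT·e^{−κ·tdist b b′}⟩·θ²`, whose CLOSED FORM is LEAD pen 11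
(✓`…OrganTangentSeedLetterShape.seedLetter_eq`): `kT b b′ = (800·√(32B)·√(800·√(6B))∕r²)·√√σ`, with `√√(ωT·e^{−κd}) = √√ωT·e^{−κd∕4}`
(✓`sqrt_sqrt_mul_exp_neg`) — the σ^{1∕4} road divides the decay rate by 4 (spec §2 «BOOKED COST»).  THIS FILE types the row-mass in EXACTLY that
letter shape (pen 9's constant VERBATIM, times `θ ^ 2`, times the weight `Real.exp (κ′ * (b.src.tdist b′.src : ℝ))`), for ANY `Params`, any level:
* `seedLetter_nonneg` — the `∀ b b′, 0 ≤ k b b′` clause;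
* `seedLetter_mul_exp_eq` — termwise: `kT b b′·e^{κ′d} = C_H·√√ωT·e^{−(κ∕4 − κ′)d}`;
* ★★`rowMass_seedLetter_le` — `∑ b′, kT b b′·e^{κ′·tdist} ≤ C_H·√√ωT·(d·(2(1 + 1∕(κ∕4 − κ′)))^d)` for `κ′ < κ∕4`, over w4 ✓p788607
  `…OrganTangentBondRowSum.sum_pbond_exp_neg_mul_tdist_src_le` at `a := κ∕4 − κ′` (itself over ✓`Prop7TorusExpWeightSum.sum_exp_neg_mul_tdist_le`,
  the tree twin of ✓`B3TorusRadialSums.sum_exp_neg_tdist_le`);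
* `rowMass_seedLetter_div_four_le` ∕ `seedLetter_div_four_nonneg` ∕ ★`seedLetters_rowMassPackage_div_four` — the same for v1.5 (ii)'s
  once-converted seed letters `k := kT∕4` (O1ᵘ-H v2 ∕ S3ᴴ seed triple at `θ := θBal∕2`, ideator g27 `V18DraftTexts`);
* ★`seedLetters_rowMassPackage` — the two input clauses of O1ᵘ-H's presentation packaged: `(∀ b b′, 0 ≤ kT b b′) ∧ (∀ b, ∑ b′, kT b b′·e^{κ′·tdist} ≤ w)`
  with `w := C_H·ωT^{1∕4}·d·(2(1 + 1∕(κ∕4 − κ′)))^d`;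
* `rowMass_seedLetter_le_three` — the d = 3 reading on the family's tori `F.P K`: `… ≤ C_H·√√ωT·(3·(2(1 + 1∕(κ∕4 − κ′)))³)`.
All constants θ-FREE (window-scale uniform), `j`∕`K`∕side-uniform; `ωT` enters as `ωT^{1∕4} = √√ωT` (floor-class seed smallness must beat the
`B^{3∕4}` prefactor — spec §2, booked there).

HONEST: elementary real arithmetic and a geometric series on the discrete torus (both already in the tree BY NAME); nothing of Bałaban's analysis is
asserted or proved; the seed clause and (β) for the runs are HYPOTHESES of pen 9; O1ᵘ-H (v2), S3ᴴ, `directTransport_supR`, the five registered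
∘-stubs, crux 20520 `FluctuationComparisonRegPrIntL` and `YM3TorusSU2` are NOT proved; no summit is proved by a row sum.  R3 = SU(2) YM₃ on T³ —
NOT d = 4, NOT infinite volume, NOT a mass gap, NOT Clay; the Yang–Mills mass gap is NOT proved.
[cite: Balaban1985UV3, p.263; Balaban1984PropagatorsII, (2.61) p.234]
-/

set_option autoImplicit false

noncomputable section

namespace Summit.QuantumFields.YangMills.Theorems.OrganTangentSeedRowMass

open Literature.MathematicalPhysics.QuantumFieldTheory.Balaban1983to89
open Summit.QuantumFields.YangMills.Theorems.OrganTangentSeedLetterShape (seedLetter_eq sqrt_sqrt_mul_exp_neg)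
open Summit.QuantumFields.YangMills.Theorems.OrganTangentBondRowSum (sum_pbond_exp_neg_mul_tdist_src_le)

variable {P : Params} {j : ℕ}

/-! ## §1 The seed letters termwise: nonnegativity and the weighted closed form -/

/-- THE `0 ≤ k b b′` CLAUSE: pen 9's seed letter `kT b b′` (✓p797938's constant at `σ := ωT·e^{−κ·tdist b b′}`, times `θ²`) is nonnegative —
by the closed form ✓`seedLetter_eq` it is `C_H(B,r)·√√σ`. [folklore] -/
theorem seedLetter_nonneg {θ r B ωT : ℝ} (hθ : 0 < θ) (hr : 0 < r) (hB : 0 < B) (hω : 0 < ωT) (κ : ℝ) (b b' : PBond P j) :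
    0 ≤ (25 * (2 * (4 * (3 * B) / (r * θ - r * θ / 4))) ^ (1 / 2 : ℝ) / (r * θ / 8 * (1 / 2 : ℝ) ^ 2) *
        (25 * (2 * (3 * B)) ^ (1 / 2 : ℝ) / (r * θ / 8 * (1 / 2 : ℝ) ^ 2) *
          (ωT * Real.exp (-(κ * (b.src.tdist b'.src : ℝ)))) ^ (1 - 1 / 2 : ℝ)) ^ (1 - 1 / 2 : ℝ)) * θ ^ 2 := by
  rw [seedLetter_eq hθ hr hB (mul_pos hω (Real.exp_pos _))]
  positivity

/-- TERMWISE WEIGHTED CLOSED FORM: `kT b b′·e^{κ′·tdist} = (800·√(32B)·√(800·√(6B))∕r²)·√√ωT·e^{−(κ∕4 − κ′)·tdist}` — ✓`seedLetter_eq`, then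
✓`sqrt_sqrt_mul_exp_neg` (`√√(ωT·e^{−κd}) = √√ωT·e^{−κd∕4}`), then `e^{−κd∕4}·e^{κ′d} = e^{−(κ∕4 − κ′)d}`. [folklore] -/
theorem seedLetter_mul_exp_eq {θ r B ωT : ℝ} (hθ : 0 < θ) (hr : 0 < r) (hB : 0 < B) (hω : 0 < ωT) (κ κ' : ℝ) (b b' : PBond P j) :
    (25 * (2 * (4 * (3 * B) / (r * θ - r * θ / 4))) ^ (1 / 2 : ℝ) / (r * θ / 8 * (1 / 2 : ℝ) ^ 2) *
        (25 * (2 * (3 * B)) ^ (1 / 2 : ℝ) / (r * θ / 8 * (1 / 2 : ℝ) ^ 2) *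
          (ωT * Real.exp (-(κ * (b.src.tdist b'.src : ℝ)))) ^ (1 - 1 / 2 : ℝ)) ^ (1 - 1 / 2 : ℝ)) * θ ^ 2 *
        Real.exp (κ' * (b.src.tdist b'.src : ℝ)) =
      800 * Real.sqrt (32 * B) * Real.sqrt (800 * Real.sqrt (6 * B)) / r ^ 2 * Real.sqrt (Real.sqrt ωT) *
        Real.exp (-((κ / 4 - κ') * (b.src.tdist b'.src : ℝ))) := by
  rw [seedLetter_eq hθ hr hB (mul_pos hω (Real.exp_pos _)), sqrt_sqrt_mul_exp_neg hω.le]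
  have hexp : Real.exp (-(κ * (b.src.tdist b'.src : ℝ)) / 4) * Real.exp (κ' * (b.src.tdist b'.src : ℝ)) =
      Real.exp (-((κ / 4 - κ') * (b.src.tdist b'.src : ℝ))) := by
    rw [← Real.exp_add]
    ring_nf
  calc 800 * Real.sqrt (32 * B) * Real.sqrt (800 * Real.sqrt (6 * B)) / r ^ 2 *
          (Real.sqrt (Real.sqrt ωT) * Real.exp (-(κ * (b.src.tdist b'.src : ℝ)) / 4)) * Real.exp (κ' * (b.src.tdist b'.src : ℝ))
      = 800 * Real.sqrt (32 * B) * Real.sqrt (800 * Real.sqrt (6 * B)) / r ^ 2 * Real.sqrt (Real.sqrt ωT) *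
          (Real.exp (-(κ * (b.src.tdist b'.src : ℝ)) / 4) * Real.exp (κ' * (b.src.tdist b'.src : ℝ))) := by ring
    _ = _ := by rw [hexp]

/-! ## §2 ★★ ROWMASS-¼: the weighted row sum of the seed letters is θ-free and side-uniform -/

/-- ★★ **ROWMASS-¼**: for `κ′ < κ∕4` and every bond `b` of ANY lattice `P`, level `j`,
`∑_{b′} kT b b′·e^{κ′·tdist(b, b′)} ≤ (800·√(32B)·√(800·√(6B))∕r²)·√√ωT·(d·(2(1 + 1∕(κ∕4 − κ′)))^d)` — the termwise closed form
(`seedLetter_mul_exp_eq`) pulled out of the sum (`Finset.mul_sum`) and w4's bond row sum ✓`sum_pbond_exp_neg_mul_tdist_src_le` at rate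
`a := κ∕4 − κ′ > 0`.  This is O1ᵘ-H's input row-mass clause `∀ b, ∑ b′, k b b′ * Real.exp (κ′ * (b.src.tdist b′.src : ℝ)) ≤ w` for `k := kT`,
`w := C_H·ωT^{1∕4}·C(κ∕4 − κ′, d)`, uniform in θ, the level and the side of the torus. [cite: Balaban1984PropagatorsII, (2.61) p.234] -/
theorem rowMass_seedLetter_le {θ r B ωT κ κ' : ℝ} (hθ : 0 < θ) (hr : 0 < r) (hB : 0 < B) (hω : 0 < ωT) (hκ' : κ' < κ / 4)
    (b : PBond P j) :
    ∑ b' : PBond P j,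
        (25 * (2 * (4 * (3 * B) / (r * θ - r * θ / 4))) ^ (1 / 2 : ℝ) / (r * θ / 8 * (1 / 2 : ℝ) ^ 2) *
            (25 * (2 * (3 * B)) ^ (1 / 2 : ℝ) / (r * θ / 8 * (1 / 2 : ℝ) ^ 2) *
              (ωT * Real.exp (-(κ * (b.src.tdist b'.src : ℝ)))) ^ (1 - 1 / 2 : ℝ)) ^ (1 - 1 / 2 : ℝ)) * θ ^ 2 *
          Real.exp (κ' * (b.src.tdist b'.src : ℝ)) ≤
      800 * Real.sqrt (32 * B) * Real.sqrt (800 * Real.sqrt (6 * B)) / r ^ 2 * Real.sqrt (Real.sqrt ωT) *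
        ((P.d : ℝ) * (2 * (1 + 1 / (κ / 4 - κ'))) ^ P.d) := by
  have ha : 0 < κ / 4 - κ' := sub_pos.mpr hκ'
  calc ∑ b' : PBond P j,
          (25 * (2 * (4 * (3 * B) / (r * θ - r * θ / 4))) ^ (1 / 2 : ℝ) / (r * θ / 8 * (1 / 2 : ℝ) ^ 2) *
              (25 * (2 * (3 * B)) ^ (1 / 2 : ℝ) / (r * θ / 8 * (1 / 2 : ℝ) ^ 2) *
                (ωT * Real.exp (-(κ * (b.src.tdist b'.src : ℝ)))) ^ (1 - 1 / 2 : ℝ)) ^ (1 - 1 / 2 : ℝ)) * θ ^ 2 *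
            Real.exp (κ' * (b.src.tdist b'.src : ℝ))
      = ∑ b' : PBond P j, 800 * Real.sqrt (32 * B) * Real.sqrt (800 * Real.sqrt (6 * B)) / r ^ 2 * Real.sqrt (Real.sqrt ωT) *
          Real.exp (-((κ / 4 - κ') * (b.src.tdist b'.src : ℝ))) :=
        Finset.sum_congr rfl fun b' _ => seedLetter_mul_exp_eq hθ hr hB hω κ κ' b b'
    _ = 800 * Real.sqrt (32 * B) * Real.sqrt (800 * Real.sqrt (6 * B)) / r ^ 2 * Real.sqrt (Real.sqrt ωT) *
          ∑ b' : PBond P j, Real.exp (-((κ / 4 - κ') * (b.src.tdist b'.src : ℝ))) := by rw [Finset.mul_sum]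
    _ ≤ 800 * Real.sqrt (32 * B) * Real.sqrt (800 * Real.sqrt (6 * B)) / r ^ 2 * Real.sqrt (Real.sqrt ωT) *
          ((P.d : ℝ) * (2 * (1 + 1 / (κ / 4 - κ'))) ^ P.d) :=
        mul_le_mul_of_nonneg_left (sum_pbond_exp_neg_mul_tdist_src_le b ha) (by positivity)

/-- THE ONCE-CONVERTED SEED LETTERS (spec v1.5 (ii): O1ᵘ-H v2 at `θ := θBal∕2`, `k := kT∕4`): the same row-mass bound divided by `4`. [folklore] -/
theorem rowMass_seedLetter_div_four_le {θ r B ωT κ κ' : ℝ} (hθ : 0 < θ) (hr : 0 < r) (hB : 0 < B) (hω : 0 < ωT) (hκ' : κ' < κ / 4)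
    (b : PBond P j) :
    ∑ b' : PBond P j,
        (25 * (2 * (4 * (3 * B) / (r * θ - r * θ / 4))) ^ (1 / 2 : ℝ) / (r * θ / 8 * (1 / 2 : ℝ) ^ 2) *
            (25 * (2 * (3 * B)) ^ (1 / 2 : ℝ) / (r * θ / 8 * (1 / 2 : ℝ) ^ 2) *
              (ωT * Real.exp (-(κ * (b.src.tdist b'.src : ℝ)))) ^ (1 - 1 / 2 : ℝ)) ^ (1 - 1 / 2 : ℝ)) * θ ^ 2 / 4 *
          Real.exp (κ' * (b.src.tdist b'.src : ℝ)) ≤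
      800 * Real.sqrt (32 * B) * Real.sqrt (800 * Real.sqrt (6 * B)) / r ^ 2 * Real.sqrt (Real.sqrt ωT) *
        ((P.d : ℝ) * (2 * (1 + 1 / (κ / 4 - κ'))) ^ P.d) / 4 := by
  have h := rowMass_seedLetter_le (P := P) (j := j) hθ hr hB hω hκ' b
  have hrew : ∀ b' : PBond P j,
      (25 * (2 * (4 * (3 * B) / (r * θ - r * θ / 4))) ^ (1 / 2 : ℝ) / (r * θ / 8 * (1 / 2 : ℝ) ^ 2) *
            (25 * (2 * (3 * B)) ^ (1 / 2 : ℝ) / (r * θ / 8 * (1 / 2 : ℝ) ^ 2) *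
              (ωT * Real.exp (-(κ * (b.src.tdist b'.src : ℝ)))) ^ (1 - 1 / 2 : ℝ)) ^ (1 - 1 / 2 : ℝ)) * θ ^ 2 / 4 *
          Real.exp (κ' * (b.src.tdist b'.src : ℝ)) =
        (1 / 4 : ℝ) * ((25 * (2 * (4 * (3 * B) / (r * θ - r * θ / 4))) ^ (1 / 2 : ℝ) / (r * θ / 8 * (1 / 2 : ℝ) ^ 2) *
            (25 * (2 * (3 * B)) ^ (1 / 2 : ℝ) / (r * θ / 8 * (1 / 2 : ℝ) ^ 2) *
              (ωT * Real.exp (-(κ * (b.src.tdist b'.src : ℝ)))) ^ (1 - 1 / 2 : ℝ)) ^ (1 - 1 / 2 : ℝ)) * θ ^ 2 *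
          Real.exp (κ' * (b.src.tdist b'.src : ℝ))) := fun b' => by ring
  rw [Finset.sum_congr rfl fun b' _ => hrew b', ← Finset.mul_sum]
  linarith

/-- ★ **THE DOCKING FORM** — O1ᵘ-H's two input-letter clauses packaged for `k := kT`: `(∀ b b′, 0 ≤ kT b b′) ∧ (∀ b, ∑ b′, kT b b′·e^{κ′·tdist} ≤ w)`
with the θ-free, side-uniform `w := (800·√(32B)·√(800·√(6B))∕r²)·√√ωT·(d·(2(1 + 1∕(κ∕4 − κ′)))^d)`. [cite: Balaban1985UV3, p.263] -/
theorem seedLetters_rowMassPackage {θ r B ωT κ κ' : ℝ} (hθ : 0 < θ) (hr : 0 < r) (hB : 0 < B) (hω : 0 < ωT) (hκ' : κ' < κ / 4) :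
    (∀ b b' : PBond P j,
        0 ≤ (25 * (2 * (4 * (3 * B) / (r * θ - r * θ / 4))) ^ (1 / 2 : ℝ) / (r * θ / 8 * (1 / 2 : ℝ) ^ 2) *
            (25 * (2 * (3 * B)) ^ (1 / 2 : ℝ) / (r * θ / 8 * (1 / 2 : ℝ) ^ 2) *
              (ωT * Real.exp (-(κ * (b.src.tdist b'.src : ℝ)))) ^ (1 - 1 / 2 : ℝ)) ^ (1 - 1 / 2 : ℝ)) * θ ^ 2) ∧
    (∀ b : PBond P j,
        ∑ b' : PBond P j,
            (25 * (2 * (4 * (3 * B) / (r * θ - r * θ / 4))) ^ (1 / 2 : ℝ) / (r * θ / 8 * (1 / 2 : ℝ) ^ 2) *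
                (25 * (2 * (3 * B)) ^ (1 / 2 : ℝ) / (r * θ / 8 * (1 / 2 : ℝ) ^ 2) *
                  (ωT * Real.exp (-(κ * (b.src.tdist b'.src : ℝ)))) ^ (1 - 1 / 2 : ℝ)) ^ (1 - 1 / 2 : ℝ)) * θ ^ 2 *
              Real.exp (κ' * (b.src.tdist b'.src : ℝ)) ≤
          800 * Real.sqrt (32 * B) * Real.sqrt (800 * Real.sqrt (6 * B)) / r ^ 2 * Real.sqrt (Real.sqrt ωT) *
            ((P.d : ℝ) * (2 * (1 + 1 / (κ / 4 - κ'))) ^ P.d)) :=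
  ⟨fun b b' => seedLetter_nonneg hθ hr hB hω κ b b', fun b => rowMass_seedLetter_le hθ hr hB hω hκ' b⟩

/-- The once-converted seed letters `kT∕4` are nonnegative (the `∀ b b′, 0 ≤ k b b′` clause of v1.5 (ii)'s seed presentation). [folklore] -/
theorem seedLetter_div_four_nonneg {θ r B ωT : ℝ} (hθ : 0 < θ) (hr : 0 < r) (hB : 0 < B) (hω : 0 < ωT) (κ : ℝ) (b b' : PBond P j) :
    0 ≤ (25 * (2 * (4 * (3 * B) / (r * θ - r * θ / 4))) ^ (1 / 2 : ℝ) / (r * θ / 8 * (1 / 2 : ℝ) ^ 2) *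
        (25 * (2 * (3 * B)) ^ (1 / 2 : ℝ) / (r * θ / 8 * (1 / 2 : ℝ) ^ 2) *
          (ωT * Real.exp (-(κ * (b.src.tdist b'.src : ℝ)))) ^ (1 - 1 / 2 : ℝ)) ^ (1 - 1 / 2 : ℝ)) * θ ^ 2 / 4 :=
  div_nonneg (seedLetter_nonneg hθ hr hB hω κ b b') (by norm_num)

/-- ★ **THE DOCKING FORM FOR THE ONCE-CONVERTED SEED** (v1.5 (ii); ideator g27's `V18DraftTexts` S3ᴴ seed triple with `kT := K·θ²∕4` at
`θ := θBal∕2`): `(∀ b b′, 0 ≤ kT b b′∕4) ∧ (∀ b, ∑ b′, kT b b′∕4·e^{κ′·tdist} ≤ w∕4)`. [cite: Balaban1985UV3, p.263] -/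
theorem seedLetters_rowMassPackage_div_four {θ r B ωT κ κ' : ℝ} (hθ : 0 < θ) (hr : 0 < r) (hB : 0 < B) (hω : 0 < ωT)
    (hκ' : κ' < κ / 4) :
    (∀ b b' : PBond P j,
        0 ≤ (25 * (2 * (4 * (3 * B) / (r * θ - r * θ / 4))) ^ (1 / 2 : ℝ) / (r * θ / 8 * (1 / 2 : ℝ) ^ 2) *
            (25 * (2 * (3 * B)) ^ (1 / 2 : ℝ) / (r * θ / 8 * (1 / 2 : ℝ) ^ 2) *
              (ωT * Real.exp (-(κ * (b.src.tdist b'.src : ℝ)))) ^ (1 - 1 / 2 : ℝ)) ^ (1 - 1 / 2 : ℝ)) * θ ^ 2 / 4) ∧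
    (∀ b : PBond P j,
        ∑ b' : PBond P j,
            (25 * (2 * (4 * (3 * B) / (r * θ - r * θ / 4))) ^ (1 / 2 : ℝ) / (r * θ / 8 * (1 / 2 : ℝ) ^ 2) *
                (25 * (2 * (3 * B)) ^ (1 / 2 : ℝ) / (r * θ / 8 * (1 / 2 : ℝ) ^ 2) *
                  (ωT * Real.exp (-(κ * (b.src.tdist b'.src : ℝ)))) ^ (1 - 1 / 2 : ℝ)) ^ (1 - 1 / 2 : ℝ)) * θ ^ 2 / 4 *
              Real.exp (κ' * (b.src.tdist b'.src : ℝ)) ≤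
          800 * Real.sqrt (32 * B) * Real.sqrt (800 * Real.sqrt (6 * B)) / r ^ 2 * Real.sqrt (Real.sqrt ωT) *
            ((P.d : ℝ) * (2 * (1 + 1 / (κ / 4 - κ'))) ^ P.d) / 4) :=
  ⟨fun b b' => seedLetter_div_four_nonneg hθ hr hB hω κ b b', fun b => rowMass_seedLetter_div_four_le hθ hr hB hω hκ' b⟩

/-! ## §3 The d = 3 reading on the family's tori -/

/-- **d = 3 READING ON THE FAMILY'S TORI** (the constant the junction books, uniform in the height `j`, the run `K` and the side):
`∑_{b′ : PBond (F.P K) j} kT b b′·e^{κ′·tdist} ≤ (800·√(32B)·√(800·√(6B))∕r²)·√√ωT·(3·(2(1 + 1∕(κ∕4 − κ′)))³)`.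
[cite: Balaban1984PropagatorsII, (2.61) p.234; Balaban1985Propagators, (1.19) p.393] -/
theorem rowMass_seedLetter_le_three (F : T3ContinuumYM3Torus.T3Family) (K j : ℕ) {θ r B ωT κ κ' : ℝ} (hθ : 0 < θ) (hr : 0 < r)
    (hB : 0 < B) (hω : 0 < ωT) (hκ' : κ' < κ / 4) (b : PBond (F.P K) j) :
    ∑ b' : PBond (F.P K) j,
        (25 * (2 * (4 * (3 * B) / (r * θ - r * θ / 4))) ^ (1 / 2 : ℝ) / (r * θ / 8 * (1 / 2 : ℝ) ^ 2) *
            (25 * (2 * (3 * B)) ^ (1 / 2 : ℝ) / (r * θ / 8 * (1 / 2 : ℝ) ^ 2) *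
              (ωT * Real.exp (-(κ * (b.src.tdist b'.src : ℝ)))) ^ (1 - 1 / 2 : ℝ)) ^ (1 - 1 / 2 : ℝ)) * θ ^ 2 *
          Real.exp (κ' * (b.src.tdist b'.src : ℝ)) ≤
      800 * Real.sqrt (32 * B) * Real.sqrt (800 * Real.sqrt (6 * B)) / r ^ 2 * Real.sqrt (Real.sqrt ωT) *
        (3 * (2 * (1 + 1 / (κ / 4 - κ'))) ^ 3) := by
  have h := rowMass_seedLetter_le (P := F.P K) (j := j) hθ hr hB hω hκ' b
  have hd : (F.P K).d = 3 := rfl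
  rw [hd] at h
  exact_mod_cast h

end Summit.QuantumFields.YangMills.Theorems.OrganTangentSeedRowMass

end
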